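import Summits.ABC.IUTFork.Repair.CandJoshi3Boundary
import Summits.ABC.IUTFork.Repair.CandJoshi34
import Summits.ABC.IUTFork.Cor312UnitCosetCoarse
import HarnessLib

/-!
# IUT REPAIR branch (rung LADDER-ABC:A2.RP), class (iii) JOSHI, row RP-J02a — `CandJoshi3BoundaryBeds`: the q-envelope boundary law
# (`CandJoshi3Boundary`, p460194) at the TWO remaining confined beds of record — COV (the cell of record) and the COARSE-FRAME coset bed K

PROOF-ONLY sequel (D-0012; no definition, no `Prop` fact, no instance; seat abc-iut-rp-j1, gen 5) of `Repair/CandJoshi3Boundary` (the LAW: on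
q-CONFINED data — every possible image of the Θ-pilot inside the q-pilot region — the typed Corollary 3.12 holds at most AT EQUALITY, and at
equality iff the holomorphic hull FILLS the q-region packetwise; H_J3 `CandJoshi3.LocusCovers` reaches the boundary with no volume axiom).
TAKES NO SIDE on [IUTchIII] Cor. 3.12 or on any author; cells about MODEL beds of the typed interface, cited BY NAME; typed ≠ proved; model data ≠
intended objects. Two cells, which together show that the boundary `−|log(Θ)| = −|log(q)|` of the confined regime is reached along BOTH routes
the law allows:
* §1 **COV** (abc-iut-rp-j3's orbit-COVERING bed `CoveringWitness.covSetting`, the union-cover cell of record, p448953; FIRST construction of the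
  mechanism): q-confined (`cov_confined`: the union of the possible images IS the q-ball, `CoveringWitness.sUnion_possibleImages`), and its
  equality RE-DERIVED through the law's volume-free §3 from the q-pin `cov_qPinned` + H_J3 `CandJoshi34.locusCovers_cov` (`cov_boundary_by_law`;
  concordant with the bed's own `covSetting_negLogTheta` / `covSetting_statement`). Route: THE UNION FILLS `q·𝒪`.
* §2 **K** (abc-iut-w4-d101's COARSE-FRAME coset bed `UnitCosetCoarse.kSetting`, p43xxxx: Θ-images the sign pairs `±q^{j²}(1+p𝒪)`, isometric
  unit-group (Ind2) MOVING them, hull frame `{𝒪, q𝒪}`): q-confined (`k_confined`: every possible image lies in `B_{j²} ⊆ B_1 = q𝒪`,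
  `UnitCosetCoarse.sUnion_possibleImages_subset`), at the boundary (`kSetting_negLogTheta_eq_negLogQ`), with hull = q-region in every packet of
  `𝔽_l^⋇` RE-DERIVED from the bed's licence through `licence_iff_thetaHull_eq_of_confined` (`k_confined_boundary`) — **while H_J3 FAILS there**
  (`k_not_locusCovers`: the union stays inside `B_4 ⊊ B_1` at label 2). Route: THE FRAME FILLS `q·𝒪` (the smallest hull-set containing `B_{j²}` is
  `q𝒪` itself) — the boundary WITHOUT union covering. So within the confined regime H_J3 is SUFFICIENT for the boundary (COV, P♮∪) and NOT
  NECESSARY (K); what is necessary and sufficient is the hull-level licence (`CandJoshi3Boundary.statement_iff_licence_of_confined`).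
[claim: Mochizuki2012, status: disputed] [claim: Joshi2021ATSII, status: disputed] [cite: ScholzeStix2018, §2.2 pp. 9–10]
-/

noncomputable section

open Set

namespace Summit.ABC.IUTFork.Repair.CandJoshi3Boundary

open Thm311 Cor312 Cor312Vol Literature.IUT.LogThetaLattice Summit.ABC.IUTFork.Repair.CandJoshi3

section CovK

open Cor312Vol.CoveringWitness Cor312Vol.UnitCosetCoarse Cor312Vol.UnitWitness Cor312Vol.UnitCoset Cor312Vol.NaiveWitness

variable (p : ℕ) [hp : Fact p.Prime]

/-! ## 1. COV — the union fills the q-ball -/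

/-- **COV is q-confined** at every packet: the union of the possible images IS the q-ball (`CoveringWitness.sUnion_possibleImages`,
`covSetting_qRegion`). [folklore] -/
theorem cov_confined (j : Checks.toyIndex.Label) (vQ : Checks.toyIndex.VQ) :
    ∀ U ∈ (covSetting p).possibleImages j vQ, U ⊆ (covSetting p).qRegion j vQ := fun U hU => by
  rw [covSetting_qRegion, ← sUnion_possibleImages p j vQ]
  exact Set.subset_sUnion_of_mem hU

/-- **COV's equality RE-DERIVED THROUGH THE LAW** (volume-free §3 of `CandJoshi3Boundary`): q-pin `cov_qPinned` + H_J3 `CandJoshi34.locusCovers_cov`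
+ confinement + trivial `HasHull` ⟹ Statement ∧ `−|log(Θ)| = −|log(q)|`; concordant with `covSetting_statement` / `covSetting_negLogTheta = −1 =
covSetting_negLogQ`. [folklore] -/
theorem cov_boundary_by_law :
    (covSetting p).Statement ∧ (covSetting p).negLogTheta = (((covSetting p).negLogQ : ℝ) : WithTop ℝ) :=
  boundary_of_locusCovers (covFull p).toLatticeSituation (covSetting p) (rho p) (covQK p) (cov_qPinned p)
    (CandJoshi34.locusCovers_cov p) (fun _ vQ => cov_confined p _ vQ) fun _ _ => trivial

/-! ## 2. K — the frame fills the q-ball, the union does not -/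

/-- **K is q-confined** on `𝔽_l^⋇`: every possible image (a unit translate of the pair `±q^{j²}(1+p𝒪)`) lies in `B_{j²} ⊆ B_1 = q𝒪`
(`UnitCosetCoarse.sUnion_possibleImages_subset`, `uBall_mono`, `kSetting_qRegion`). [folklore] -/
theorem k_confined (i : Fin Checks.toyIndex.lstar) (vQ : Checks.toyIndex.VQ) :
    ∀ U ∈ (kSetting p).possibleImages (Setting.labelSucc i) vQ, U ⊆ (kSetting p).qRegion (Setting.labelSucc i) vQ := fun U hU => by
  have hj := Setting.labelSucc_ne_zero i
  rw [kSetting_qRegion p hj]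
  exact ((Set.subset_sUnion_of_mem hU).trans (sUnion_possibleImages_subset p hj vQ)).trans
    (uBall_mono p _ vQ (one_le_jsq_of_ne_zero hj))

/-- **K sits ON the boundary through the FRAME**: confined, `−|log(Θ)| = −|log(q)|` (`kSetting_negLogTheta_eq_negLogQ`), and the hull IS the
q-region in every packet of `𝔽_l^⋇` — here re-derived from the bed's licence `kSetting_licence` through `licence_iff_thetaHull_eq_of_confined`
(concordant with `kSetting_thetaHull`). [folklore] -/
theorem k_confined_boundary :
    (∀ (i : Fin Checks.toyIndex.lstar) (vQ : Checks.toyIndex.VQ),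
        ∀ U ∈ (kSetting p).possibleImages (Setting.labelSucc i) vQ, U ⊆ (kSetting p).qRegion (Setting.labelSucc i) vQ) ∧
      (kSetting p).negLogTheta = (((kSetting p).negLogQ : ℝ) : WithTop ℝ) ∧
        ∀ (i : Fin Checks.toyIndex.lstar) (vQ : Checks.toyIndex.VQ),
          (kSetting p).thetaHull (Setting.labelSucc i) vQ = (kSetting p).qRegion (Setting.labelSucc i) vQ :=
  ⟨k_confined p, kSetting_negLogTheta_eq_negLogQ p,
    (licence_iff_thetaHull_eq_of_confined (kFull p).toLatticeSituation (kSetting p) (k_confined p)).1 (kSetting_licence p)⟩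

/-- **… while H_J3 FAILS at K**: under the q-pin the covering hypothesis would force `⋃ possibleImages = qRegion = B_1` at label `2`
(`sUnion_possibleImages_eq_qRegion_of_locusCovers`), but the union lies in `B_4` (`sUnion_possibleImages_subset`) and `B_4 ≠ B_1` (`uBall_injective`).
The boundary is reached WITHOUT union covering — by the coarse frame. [folklore] -/
theorem k_not_locusCovers : ¬ LocusCovers (kFull p).toLatticeSituation (kSetting p) (cosetRegion p) (idealDatum p) := fun hJ => by
  set i₁ : Fin Checks.toyIndex.lstar := ⟨1, by decide⟩ with hi₁
  have hj := Setting.labelSucc_ne_zero i₁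
  have hU := sUnion_possibleImages_eq_qRegion_of_locusCovers (kFull p).toLatticeSituation (kSetting p) (cosetRegion p) (idealDatum p)
    (kSetting_pinnedRegions3 p).1.2 hJ (k_confined p i₁ ())
  rw [kSetting_qRegion p hj] at hU
  have hsub : uBall p (Setting.labelSucc i₁) () 1 ⊆ uBall p (Setting.labelSucc i₁) () (jsq (Setting.labelSucc i₁)) :=
    hU.symm.subset.trans (sUnion_possibleImages_subset p hj ())
  have heq : uBall p (Setting.labelSucc i₁) () 1 = uBall p (Setting.labelSucc i₁) () (jsq (Setting.labelSucc i₁)) :=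
    Set.Subset.antisymm hsub (uBall_mono p _ () (one_le_jsq_of_ne_zero hj))
  have h14 : jsq (Setting.labelSucc i₁) = 4 := by rw [hi₁]; decide
  have := uBall_injective p _ () heq
  rw [h14] at this
  exact absurd this (by norm_num)

/-- **THE TWO ROUTES TO THE BOUNDARY, side by side** (for §J): COV — union covering (H_J3 ✓); K — frame filling (H_J3 ✗); both q-confined, both at
`−|log(Θ)| = −|log(q)|`, both with hull = q-region packetwise. Within the confined regime H_J3 is sufficient, not necessary; the licence is both
(`statement_iff_licence_of_confined`). [folklore] -/
theorem two_routes_to_the_boundary :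
    ((covSetting p).negLogTheta = (((covSetting p).negLogQ : ℝ) : WithTop ℝ) ∧
        LocusCovers (covFull p).toLatticeSituation (covSetting p) (rho p) (covQK p)) ∧
      ((kSetting p).negLogTheta = (((kSetting p).negLogQ : ℝ) : WithTop ℝ) ∧
        ¬ LocusCovers (kFull p).toLatticeSituation (kSetting p) (cosetRegion p) (idealDatum p)) :=
  ⟨⟨(cov_boundary_by_law p).2, CandJoshi34.locusCovers_cov p⟩, ⟨kSetting_negLogTheta_eq_negLogQ p, k_not_locusCovers p⟩⟩

end CovK

end Summit.ABC.IUTFork.Repair.CandJoshi3Boundary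

end
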